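import Literature.NumberTheory.DiophantineGeometry.StewartPadicOrderLemma8Proofs
import Literature.NumberTheory.DiophantineGeometry.PastenSubexpDecomposition
import Literature.Barriers.ABC.BakerMethodBoundsThreeRoutesProofs
import HarnessLib

/-!
# Sub-power Stewart–Yu (crux `SubPowerStewartYu`, stmt-ABC-11053), II: the inflated family for `(u/v)²`

`Summits/ABC/ABC/Theorems/LogCardinalitySubPowerStewartYuFamily.lean` — second helper file toward
`Summit.ABC.ABC.Theses.LogCardinality.SubPowerStewartYu`.

Stewart's inflation device [cite: Stewart2013, Lemma 8 (arXiv:1008.1274 pp. 9–10)], transplanted from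
`Φ_n(a,b)` to `a + b = c`: at a prime `p ∤ uv` one has to bound `ord_p((u/v)² − 1)`, where
`u/v = ∏_{q ∣ uv} q^{e_q}` (`e_q = expDiff u v q`). Choosing one prime `q₁ ∣ uv` and a set `P` of
auxiliary primes not dividing `p·u·v`, the same number is written over the *inflated family*
indexed by `(primes of uv other than q₁) ⊕ Option P`,

  `α = (q)_{q ≠ q₁} ⊕ (q₁/∏_P r, (r)_{r ∈ P})`,  `β = (2e_q)_{q ≠ q₁} ⊕ (2e_{q₁}, …, 2e_{q₁})`,

so that `∏ αᵢ^{βᵢ} = (u/v)²` (`prod_family_zpow`); the second summand is literally the family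
`auxFamily q₁ 1 P` of `StewartPadicOrderLemma8Proofs`. This file checks the hypotheses of Yu's
theorem for it — non-vanishing, `p`-adic units, multiplicative independence (`family_multIndep`),
`β ≠ 0` — and computes its size data: number of terms, heights (`prod_max_one_logHeight₁_family_le`)
and exponents (`sum_abs_family_exp_le`). The square kills the sign `ζ = ±1` of `∓u/v`
(`ord_p(x − 1) ≤ ord_p(x² − 1)` for a `p`-adic unit `x`, used in the next file).
No new definitions: the family is the term `Sum.elim (fun q => (q : ℚ)) (auxFamily q₁ 1 P)`.
-/

noncomputable section

-- `Summit.ABC.ABC.…` is the tree's namespace convention for this sub-problem (summit = problem).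
set_option linter.dupNamespace false

open Finset Real Height
open Literature.NumberTheory.DiophantineGeometry
open Literature.NumberTheory.DiophantineGeometry.Dioph
open Literature.NumberTheory.DiophantineGeometry.Pasten

namespace Summit.ABC.ABC.Theorems.SubPowerSY

section Family

variable {u v q₁ : ℕ} {P : Finset ℕ}

/-- The auxiliary part of the family is non-zero (`q₁ ≥ 1`, primes in `P`). [folklore] -/
theorem family_ne_zero (hq₁ : 0 < q₁) (hS : ∀ q ∈ (u * v).primeFactors.erase q₁, q.Prime)
    (hP : ∀ r ∈ P, r.Prime) (i : ↥((u * v).primeFactors.erase q₁) ⊕ Option ↥P) :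
    Sum.elim (fun q : ↥((u * v).primeFactors.erase q₁) => ((q : ℕ) : ℚ)) (auxFamily q₁ 1 P) i ≠ 0 := by
  cases i with
  | inl q => simpa using (hS q q.2).ne_zero
  | inr j => exact auxFamily_ne_zero hq₁ one_pos hP j

/-- All members of the family are `p`-adic units when `p ∤ uv` and `p ∉ P`.
[cite: Stewart2013, proof of Lemma 8 (arXiv p. 9)] -/
theorem padicValRat_family {p : ℕ} (hp : p.Prime) (hpuv : ¬ p ∣ u * v)
    (hq₁ : q₁ ∈ (u * v).primeFactors) (hP : ∀ r ∈ P, r.Prime ∧ r ≠ p)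
    (i : ↥((u * v).primeFactors.erase q₁) ⊕ Option ↥P) :
    padicValRat p (Sum.elim (fun q : ↥((u * v).primeFactors.erase q₁) => ((q : ℕ) : ℚ))
      (auxFamily q₁ 1 P) i) = 0 := by
  haveI := Fact.mk hp
  cases i with
  | inl q =>
    simp only [Sum.elim_inl, padicValRat.of_nat]
    have hq := Finset.mem_of_mem_erase q.2
    have hpq : ¬ p ∣ (q : ℕ) := fun h => hpuv (h.trans (Nat.dvd_of_mem_primeFactors hq))
    exact_mod_cast padicValNat.eq_zero_of_not_dvd hpq
  | inr j =>
    simp only [Sum.elim_inr]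
    have hpq₁ : ¬ p ∣ q₁ := fun h => hpuv (h.trans (Nat.dvd_of_mem_primeFactors hq₁))
    exact padicValRat_auxFamily hp hpq₁ (by simp [hp.one_lt.ne']) hP j

/-- **Multiplicative independence of the inflated family**: distinct primes `q ≠ q₁` of `uv`, the
number `q₁ / ∏_P r` and the auxiliary primes `r ∈ P` (not dividing `uv`) are multiplicatively
independent. Proof: `ord_q` of a relation kills the exponent of each `q ≠ q₁`; the rest is
`auxFamily_multIndep`. [cite: Stewart2013, proof of Lemma 8 (arXiv p. 9)] -/
theorem family_multIndep (hq₁ : q₁ ∈ (u * v).primeFactors)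
    (hP : ∀ r ∈ P, r.Prime ∧ ¬ r ∣ u * v)
    (c : ↥((u * v).primeFactors.erase q₁) ⊕ Option ↥P → ℤ)
    (hc : ∏ i, Sum.elim (fun q : ↥((u * v).primeFactors.erase q₁) => ((q : ℕ) : ℚ))
      (auxFamily q₁ 1 P) i ^ c i = 1) : c = 0 := by
  have hq₁p : q₁.Prime := Nat.prime_of_mem_primeFactors hq₁
  have hq₁pos : 0 < q₁ := hq₁p.pos
  have hS : ∀ q ∈ (u * v).primeFactors.erase q₁, q.Prime := fun q hq =>
    Nat.prime_of_mem_primeFactors (Finset.mem_of_mem_erase hq)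
  have hPp : ∀ r ∈ P, r.Prime := fun r hr => (hP r hr).1
  have hne := family_ne_zero (u := u) (v := v) hq₁pos hS hPp
  set α := Sum.elim (fun q : ↥((u * v).primeFactors.erase q₁) => ((q : ℕ) : ℚ)) (auxFamily q₁ 1 P)
    with hα
  -- valuation of the relation at a prime `ℓ`
  have hval : ∀ ℓ : ℕ, ℓ.Prime → ∑ i, c i * padicValRat ℓ (α i) = 0 := by
    intro ℓ hℓ
    haveI := Fact.mk hℓ
    have h := congrArg (padicValRat ℓ) hc
    rw [padicValRat.one,
      padicValRat_finset_prod ℓ Finset.univ _ (fun i _ => zpow_ne_zero _ (hne i))] at h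
    simpa [padicValRat.zpow] using h
  -- Step 1: `c (inl q) = 0`
  have hinl : ∀ q : ↥((u * v).primeFactors.erase q₁), c (Sum.inl q) = 0 := by
    intro q
    obtain ⟨hqq₁, hqS⟩ := Finset.mem_erase.mp q.2
    have hq : (q : ℕ).Prime := Nat.prime_of_mem_primeFactors hqS
    haveI := Fact.mk hq
    have h := hval q hq
    rw [Fintype.sum_sum_type] at h
    -- the `inr` part vanishes: members of `auxFamily q₁ 1 P` are `q`-adic units
    have hPq : ∀ r ∈ P, r.Prime ∧ r ≠ (q : ℕ) := fun r hr =>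
      ⟨(hP r hr).1, fun h => (hP r hr).2 (h ▸ Nat.dvd_of_mem_primeFactors hqS)⟩
    have hqq₁' : ¬ (q : ℕ) ∣ q₁ := fun h => hqq₁ ((Nat.prime_dvd_prime_iff_eq hq hq₁p).mp h)
    have hinr0 : ∑ j : Option ↥P, c (Sum.inr j) * padicValRat q (α (Sum.inr j)) = 0 :=
      Finset.sum_eq_zero fun j _ => by
        rw [hα, Sum.elim_inr, padicValRat_auxFamily hq hqq₁' (by simp [hq.one_lt.ne']) hPq j,
          mul_zero]
    rw [hinr0, add_zero, Finset.sum_eq_single q] at h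
    · simp only [hα, Sum.elim_inl, padicValRat.of_nat, padicValNat_self, Nat.cast_one, mul_one] at h
      exact_mod_cast h
    · intro q' _ hq'
      rw [hα, Sum.elim_inl, padicValRat.of_nat]
      have : ¬ (q : ℕ) ∣ (q' : ℕ) := fun h =>
        hq' (Subtype.ext (((Nat.prime_dvd_prime_iff_eq hq (hS q' q'.2)).mp h).symm))
      rw [padicValNat.eq_zero_of_not_dvd this]; simp
    · intro h; exact absurd (Finset.mem_univ q) h
  -- Step 2: the auxiliary part, by `auxFamily_multIndep`
  have hprod : ∏ j : Option ↥P, auxFamily q₁ 1 P j ^ c (Sum.inr j) = 1 := by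
    have h := hc
    rw [Fintype.prod_sum_type] at h
    have h1 : ∏ q : ↥((u * v).primeFactors.erase q₁), α (Sum.inl q) ^ c (Sum.inl q) = 1 :=
      Finset.prod_eq_one fun q _ => by rw [hinl q, zpow_zero]
    rw [h1, one_mul] at h
    simpa [hα] using h
  have hPq₁ : ∀ r ∈ P, r.Prime ∧ ¬ r ∣ q₁ * 1 := fun r hr =>
    ⟨(hP r hr).1, fun h => (hP r hr).2 ((mul_one q₁ ▸ h).trans (Nat.dvd_of_mem_primeFactors hq₁))⟩
  have hinr := auxFamily_multIndep hq₁pos one_pos hq₁p.one_lt.ne' hPq₁ (fun j => c (Sum.inr j)) hprod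
  funext i
  cases i with
  | inl q => exact hinl q
  | inr j => exact congrFun hinr j

/-- **The product formula**: `∏ αᵢ^{βᵢ} = (u/v)²` for coprime positive `u, v` and `q₁ ∣ uv`.
[cite: Stewart2013, proof of Lemma 8, (31) (arXiv p. 9)] -/
theorem prod_family_zpow (hu : u ≠ 0) (hv : v ≠ 0) (huv : u.Coprime v)
    (hq₁ : q₁ ∈ (u * v).primeFactors) (hP : ∀ r ∈ P, r.Prime) :
    ∏ i, Sum.elim (fun q : ↥((u * v).primeFactors.erase q₁) => ((q : ℕ) : ℚ)) (auxFamily q₁ 1 P) i ^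
      Sum.elim (fun q : ↥((u * v).primeFactors.erase q₁) => 2 * expDiff u v q)
        (fun _ => 2 * expDiff u v q₁) i = ((u : ℚ) / v) ^ 2 := by
  rw [Fintype.prod_sum_type]
  simp only [Sum.elim_inl, Sum.elim_inr]
  have haux : ∏ j : Option ↥P, auxFamily q₁ 1 P j ^ (2 * expDiff u v q₁) =
      ((q₁ : ℚ)) ^ (2 * expDiff u v q₁) := by
    rw [Finset.prod_zpow]
    have h1 := prod_auxFamily_zpow (a := q₁) (P := P) one_pos hP 1
    simp only [Nat.cast_one, zpow_one, pow_one, div_one] at h1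
    rw [h1]
  rw [haux, Finset.prod_coe_sort ((u * v).primeFactors.erase q₁)
    (fun q : ℕ => ((q : ℚ)) ^ (2 * expDiff u v q)), Finset.prod_erase_mul _ _ hq₁,
    cast_div_eq_prod_zpow hu hv huv, ← Finset.prod_pow]
  refine Finset.prod_congr rfl fun q _ => ?_
  rw [mul_comm, zpow_mul]; norm_cast

/-- The exponent vector is non-zero (its `q₁`-coordinate is `2e_{q₁} ≠ 0`). [folklore] -/
theorem family_exp_ne_zero (hu : u ≠ 0) (hv : v ≠ 0) (huv : u.Coprime v)
    (hq₁ : q₁ ∈ (u * v).primeFactors) :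
    (Sum.elim (fun q : ↥((u * v).primeFactors.erase q₁) => 2 * expDiff u v q)
        (fun _ : Option ↥P => 2 * expDiff u v q₁)) ≠ 0 := by
  intro h
  have h1 := congrFun h (Sum.inr none)
  simp only [Sum.elim_inr, Pi.zero_apply, mul_eq_zero, OfNat.ofNat_ne_zero, false_or] at h1
  have h2 : (expDiff u v q₁).natAbs = (u * v).factorization q₁ := natAbs_expDiff hu hv huv q₁
  rw [h1, Int.natAbs_zero] at h2
  have : 0 < (u * v).factorization q₁ := Nat.Prime.factorization_pos_of_dvd
    (Nat.prime_of_mem_primeFactors hq₁) (Nat.mul_ne_zero hu hv) (Nat.dvd_of_mem_primeFactors hq₁)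
  omega

/-- Number of terms of the inflated family: `(ω(uv) − 1) + (|P| + 1) = ω(uv) + |P|`. [folklore] -/
theorem card_family (hq₁ : q₁ ∈ (u * v).primeFactors) :
    Fintype.card (↥((u * v).primeFactors.erase q₁) ⊕ Option ↥P) =
      (u * v).primeFactors.card + P.card := by
  rw [Fintype.card_sum, Fintype.card_option, Fintype.card_coe, Fintype.card_coe,
    Finset.card_erase_of_mem hq₁]
  have := Finset.card_pos.mpr ⟨q₁, hq₁⟩
  omega

/-- **Heights of the inflated family.** With `log r ≤ m` (`m ≥ 1`) for the auxiliary primes: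
`∏ᵢ max(1, h(αᵢ)) ≤ 2^{ω(uv)} · (∏_{q ∣ uv} log q) · (3 + 2|P| m) · m^{|P|}`
(`h(q) = log q ≥ log 2`, so `max(1, log q) ≤ 2 log q`; `max(1, h(q₁/∏_P r)) ≤ 1 + log q₁ + ∑_P log r`
and `1/log 2 < 3/2`). [cite: Stewart2013, proof of Lemma 8, (36) (arXiv p. 10)] -/
theorem prod_max_one_logHeight₁_family_le (hq₁ : q₁ ∈ (u * v).primeFactors)
    (hP : ∀ r ∈ P, r.Prime) {m : ℝ} (hm : 1 ≤ m) (hPm : ∀ r ∈ P, Real.log r ≤ m) :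
    ∏ i, max 1 (logHeight₁ (Sum.elim (fun q : ↥((u * v).primeFactors.erase q₁) => ((q : ℕ) : ℚ))
      (auxFamily q₁ 1 P) i)) ≤
      2 ^ (u * v).primeFactors.card * (∏ q ∈ (u * v).primeFactors, Real.log q) *
        (3 + 2 * P.card * m) * m ^ P.card := by
  have hq₁p : q₁.Prime := Nat.prime_of_mem_primeFactors hq₁
  have hlog2 : (0.6931471803 : ℝ) < Real.log 2 := Real.log_two_gt_d9
  have hlog2pos : 0 < Real.log 2 := by linarith
  have hlogq : ∀ q : ℕ, q.Prime → Real.log 2 ≤ Real.log q := fun q hq =>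
    Real.log_le_log two_pos (by exact_mod_cast hq.two_le)
  have hm0 : 0 ≤ m := zero_le_one.trans hm
  -- `max(1, x) ≤ 2x` for `x ≥ log 2`
  have hmax2 : ∀ x : ℝ, Real.log 2 ≤ x → max 1 x ≤ 2 * x := fun x hx =>
    max_le (by linarith) (by linarith)
  rw [Fintype.prod_sum_type, Fintype.prod_option]
  simp only [Sum.elim_inl, Sum.elim_inr]
  set S := (u * v).primeFactors with hSdef
  set T := S.erase q₁ with hTdef
  set LT := ∏ q ∈ T, Real.log (q : ℝ) with hLT
  -- factor 1: the primes `q ≠ q₁` of `uv`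
  have hA : ∏ q : ↥T, max 1 (logHeight₁ (((q : ℕ) : ℚ))) ≤ 2 ^ T.card * LT := by
    rw [Finset.prod_coe_sort T (fun q : ℕ => max 1 (logHeight₁ ((q : ℚ))))]
    calc ∏ q ∈ T, max 1 (logHeight₁ ((q : ℚ))) ≤ ∏ q ∈ T, 2 * Real.log q := by
          refine Finset.prod_le_prod (fun q _ => le_trans zero_le_one (le_max_left _ _)) fun q hq => ?_
          have hq' : q.Prime := Nat.prime_of_mem_primeFactors (Finset.mem_of_mem_erase hq)
          haveI : NeZero q := ⟨hq'.ne_zero⟩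
          rw [Rat.logHeight₁_natCast]
          exact hmax2 _ (hlogq q hq')
      _ = 2 ^ T.card * LT := by rw [Finset.prod_mul_distrib, Finset.prod_const]
  have hA0 : 0 ≤ ∏ q : ↥T, max 1 (logHeight₁ (((q : ℕ) : ℚ))) :=
    Finset.prod_nonneg fun q _ => le_trans zero_le_one (le_max_left _ _)
  -- factor 2: `α₁ = q₁ / ∏_P r`
  have hsumP : ∑ r ∈ P, Real.log (r : ℝ) ≤ P.card * m := by
    have := Finset.sum_le_card_nsmul P (fun r : ℕ => Real.log (r : ℝ)) m hPm
    rwa [nsmul_eq_mul] at this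
  have hB : max 1 (logHeight₁ (auxFamily q₁ 1 P none)) ≤ 1 + Real.log q₁ + P.card * m := by
    have h1 := logHeight₁_auxFamily_none_le (a := q₁) (b := 1) (P := P) hq₁p.pos one_pos hP
    rw [Nat.cast_one, Real.log_one, add_zero] at h1
    have h0 : 0 ≤ logHeight₁ (auxFamily q₁ 1 P none) := zero_le_logHeight₁ _
    have hq0 : 0 ≤ Real.log q₁ := le_trans hlog2pos.le (hlogq q₁ hq₁p)
    refine max_le ?_ ?_
    · nlinarith [mul_nonneg (Nat.cast_nonneg P.card) hm0]
    · linarith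
  have hB0 : 0 ≤ max 1 (logHeight₁ (auxFamily q₁ 1 P none)) := le_trans zero_le_one (le_max_left _ _)
  -- factor 3: the auxiliary primes
  have hC : ∏ r : ↥P, max 1 (logHeight₁ (auxFamily q₁ 1 P (some r))) ≤ m ^ P.card := by
    have h1 : ∏ r : ↥P, max 1 (logHeight₁ (auxFamily q₁ 1 P (some r))) =
        ∏ r ∈ P, max 1 (Real.log (r : ℝ)) := by
      rw [← Finset.prod_coe_sort P (fun r : ℕ => max 1 (Real.log (r : ℝ)))]
      exact Finset.prod_congr rfl fun r _ => by rw [logHeight₁_auxFamily_some hP r]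
    rw [h1]
    calc ∏ r ∈ P, max 1 (Real.log (r : ℝ)) ≤ ∏ _r ∈ P, m :=
          Finset.prod_le_prod (fun r _ => le_trans zero_le_one (le_max_left _ _))
            fun r hr => max_le hm (hPm r hr)
      _ = m ^ P.card := Finset.prod_const m
  have hC0 : 0 ≤ ∏ r : ↥P, max 1 (logHeight₁ (auxFamily q₁ 1 P (some r))) :=
    Finset.prod_nonneg fun r _ => le_trans zero_le_one (le_max_left _ _)
  -- assemble: `2^{|T|} L_T (1 + log q₁ + |P| m) m^{|P|} ≤ 2^{|S|} L_S (3 + 2|P|m) m^{|P|}`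
  have hLS : ∏ q ∈ S, Real.log (q : ℝ) = Real.log q₁ * LT :=
    (Finset.mul_prod_erase S (fun q => Real.log (q : ℝ)) hq₁).symm
  have hcard : S.card = T.card + 1 := (Finset.card_erase_add_one hq₁).symm
  have hLT0 : 0 ≤ LT := Finset.prod_nonneg fun q hq =>
    le_trans hlog2pos.le (hlogq q (Nat.prime_of_mem_primeFactors (Finset.mem_of_mem_erase hq)))
  have hkey : (1 : ℝ) + Real.log q₁ + P.card * m ≤ 2 * Real.log q₁ * (3 + 2 * P.card * m) := by
    have hq2 := hlogq q₁ hq₁p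
    have hPm0 : (0 : ℝ) ≤ P.card * m := mul_nonneg (Nat.cast_nonneg _) hm0
    nlinarith [mul_nonneg (sub_nonneg.2 hq2) hPm0]
  calc (∏ q : ↥T, max 1 (logHeight₁ (((q : ℕ) : ℚ)))) *
        (max 1 (logHeight₁ (auxFamily q₁ 1 P none)) *
          ∏ r : ↥P, max 1 (logHeight₁ (auxFamily q₁ 1 P (some r))))
      ≤ (2 ^ T.card * LT) * ((1 + Real.log q₁ + P.card * m) * m ^ P.card) :=
        mul_le_mul hA (mul_le_mul hB hC hC0 (by positivity)) (mul_nonneg hB0 hC0) (by positivity)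
    _ ≤ (2 ^ T.card * LT) * ((2 * Real.log q₁ * (3 + 2 * P.card * m)) * m ^ P.card) := by
        apply mul_le_mul_of_nonneg_left _ (by positivity)
        exact mul_le_mul_of_nonneg_right hkey (by positivity)
    _ = 2 ^ S.card * (∏ q ∈ S, Real.log (q : ℝ)) * (3 + 2 * P.card * m) * m ^ P.card := by
        rw [hLS, hcard, pow_succ]; ring

/-- **Exponents of the inflated family**: `∑ᵢ |βᵢ| ≤ 2 (|P| + 1) · ∑_{q ∣ uv} ν_q(uv)`
(each `|e_q| = ν_q(uv)` for coprime `u, v`). [folklore] -/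
theorem sum_abs_family_exp_le (hu : u ≠ 0) (hv : v ≠ 0) (huv : u.Coprime v)
    (hq₁ : q₁ ∈ (u * v).primeFactors) :
    ∑ i, |((Sum.elim (fun q : ↥((u * v).primeFactors.erase q₁) => 2 * expDiff u v q)
        (fun _ : Option ↥P => 2 * expDiff u v q₁) i : ℤ) : ℝ)| ≤
      2 * (P.card + 1) * ∑ q ∈ (u * v).primeFactors, ((u * v).factorization q : ℝ) := by
  have habs : ∀ q : ℕ, |((2 * expDiff u v q : ℤ) : ℝ)| = 2 * ((u * v).factorization q : ℝ) := by
    intro q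
    rw [Int.cast_mul, abs_mul, Int.cast_ofNat, abs_two]
    congr 1
    rw [← Int.cast_abs, Int.abs_eq_natAbs, natAbs_expDiff hu hv huv q]
    push_cast; rfl
  rw [Fintype.sum_sum_type]
  simp only [Sum.elim_inl, Sum.elim_inr, habs]
  rw [Finset.sum_const, Finset.card_univ, Fintype.card_option, Fintype.card_coe, nsmul_eq_mul,
    Finset.sum_coe_sort ((u * v).primeFactors.erase q₁)
      (fun q : ℕ => 2 * ((u * v).factorization q : ℝ))]
  have hf0 : ∀ q ∈ (u * v).primeFactors, 0 ≤ 2 * ((u * v).factorization q : ℝ) := fun q _ => by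
    positivity
  have h1 : ∑ q ∈ (u * v).primeFactors.erase q₁, 2 * ((u * v).factorization q : ℝ) =
      ∑ q ∈ (u * v).primeFactors, 2 * ((u * v).factorization q : ℝ) -
        2 * ((u * v).factorization q₁ : ℝ) := by
    rw [← Finset.add_sum_erase _ _ hq₁]; ring
  have h2 : 2 * ((u * v).factorization q₁ : ℝ) ≤
      ∑ q ∈ (u * v).primeFactors, 2 * ((u * v).factorization q : ℝ) :=
    Finset.single_le_sum hf0 hq₁
  have hsum : ∑ q ∈ (u * v).primeFactors, 2 * ((u * v).factorization q : ℝ) =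
      2 * ∑ q ∈ (u * v).primeFactors, ((u * v).factorization q : ℝ) := by rw [Finset.mul_sum]
  have hS0 : 0 ≤ ∑ q ∈ (u * v).primeFactors, ((u * v).factorization q : ℝ) :=
    Finset.sum_nonneg fun q _ => Nat.cast_nonneg _
  have hP0 : (0 : ℝ) ≤ P.card := Nat.cast_nonneg _
  push_cast
  rw [h1, hsum]
  rw [hsum] at h2
  nlinarith [mul_le_mul_of_nonneg_left h2 hP0]

/-- `∑_{q ∣ n} ν_q(n) · log 2 ≤ log n` for `n ≠ 0`. [folklore] -/
theorem sum_factorization_mul_log_two_le (n : ℕ) (hn : n ≠ 0) :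
    (∑ q ∈ n.primeFactors, (n.factorization q : ℝ)) * Real.log 2 ≤ Real.log n := by
  rw [Literature.Barriers.ABC.log_eq_sum_factorization_mul_log hn, Finset.sum_mul]
  refine Finset.sum_le_sum fun q hq => ?_
  have hq' := Nat.prime_of_mem_primeFactors hq
  exact mul_le_mul_of_nonneg_left (Real.log_le_log two_pos (by exact_mod_cast hq'.two_le))
    (Nat.cast_nonneg _)

end Family

end Summit.ABC.ABC.Theorems.SubPowerSY

end
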